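import Literature.Analysis.FunctionSpaces.TorusTrigPoly
import HarnessLib

/-!
# Real Fourier modes on `T^d`: pairings, coefficients, band-limited fields

Trunk: Sobolev (`Literature/Analysis/FunctionSpaces`). Theorem-only complements to
`TorusTrigPoly` used by the Fourier–Galerkin method for the Navier–Stokes equations on the torus
(Robinson–Rodrigo–Sadowski 2016, §4.1 and Thm. 4.4; Constantin–Foias 1988, Ch. 8; Hopf 1951,
§§2–4), at the level of generality needed by the passage to the limit (RRS Thm. 4.4, Steps 3–4,
"Hopf's method", Exercises 4.2–4.9), where the Galerkin equations are tested against the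
**single real modes** `x ↦ Re (e_k(x) z)`, `z ∈ ℂ^d`, and pairings `∫ ⟪u, a⟫` with band-limited
fields `a` are read off finitely many Fourier coefficients.

## Contents (all proved)

* `EuclideanSpace.inner_realPart_eq_re_inner`, `EuclideanSpace.complexify_realPart_eq` —
  `⟪v, Re z⟫_ℝ = Re ⟪v, z⟫_ℂ` and `Re z = ½ (z + z̄)` on `ℂ^ι`.
* Fourier coefficients of finite character sums and of finite sums of integrable functions
  (`mFourierCoeff_sum_mFourier_smul`, `mFourierCoeff_finset_sum`; Grafakos 2014, (3.1.5)).
* **The general pairing formula** `∫ ⟪w, realTrigPoly S c⟫ = ∑_{k ∈ S} Re ⟪ŵ(k), c k⟫_ℂ` for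
  every integrable real field `w` and *every* finite `S` and coefficient family `c` (no symmetry
  of `S`, no reality condition on `c`): `integral_inner_realTrigPoly_of_integrable`.
* **Fourier coefficients of a real trigonometric polynomial with arbitrary coefficients**:
  `𝓕(complexify ∘ realTrigPoly S c)(k) = ½ (𝟙_S(k) c k + conj (𝟙_S(-k) c (-k)))`
  (`mFourierCoeff_realTrigPoly_eq`); hence `realTrigPoly S c` is band-limited to `S ∪ -S`.
* `Torus.mFourierCoeff_complexify_laplacian` — `𝓕(Δa)(k) = -4π²|k|² â(k)` for smooth `a`;
  `Torus.laplacian_realTrigPoly` — `Δ realTrigPoly S c = realTrigPoly S (-4π²|k|² c k)`.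
* **Single real modes** `realTrigPoly {k} c = Re (e_k • c k)`: pointwise bound `‖·‖ ≤ ‖c k‖`,
  bounds for partial derivatives and the convective derivative along them, their Fourier
  coefficients (supported on `{k, -k}`), divergence-freeness for transversal `c k`.
* **Band-limited continuous fields are their own truncation**: if `a` is continuous and
  `â(k) = 0` off the ball `|k|² ≤ N²`, then `fourierTruncate N a = a` (`fourierTruncate_eq_self`;
  Parseval for the error plus continuity), whence `∫ ‖a‖² = ∑_{|k| ≤ N} ‖â k‖²`,
  `‖∇a‖₂² = 4π² ∑ |k|² ‖â k‖²` (`eGradNormSq`), the pairing `∫ ⟪u, a⟫ = ∑_{|k|≤N} Re ⟪û k, â k⟫`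
  for `u ∈ L²` (`integral_inner_eq_sum_of_band_limited`), and the sup bound
  `‖a x‖ ≤ ∑_{|k| ≤ N} ‖â k‖`.

## Mathlib search

Mathlib (this pin) has the characters `UnitAddTorus.mFourier`, `mFourierCoeff` and the Hilbert
basis `mFourierBasis`; no real-part calculus on `EuclideanSpace ℂ ι`, no trigonometric
polynomials as functions (searched `trigPoly`, `realPart`, `band`: nothing outside
`Literature/`). Everything here is elementary bookkeeping over `TorusTrigPoly` /
`TorusVectorParseval`.

## References

* J. C. Robinson, J. L. Rodrigo, W. Sadowski, *The three-dimensional Navier–Stokes equations*,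
  CUP 2016, §1.5 (1.10) (p. 27), §4.1 (4.1)–(4.2) (p. 71), Thm. 4.4 Steps 3–4 (pp. 75–77),
  Exercises 4.2–4.9 (pp. 85–86).
* L. Grafakos, *Classical Fourier Analysis*, 3rd ed., GTM 249 (2014), §3.1.1, (3.1.5),
  Prop. 3.2.6, Prop. 3.2.7.
-/

noncomputable section

open MeasureTheory Set Filter Topology UnitAddTorus
open scoped ENNReal NNReal InnerProductSpace ContDiff

namespace Literature.Analysis.FunctionSpaces

/-! ## Real parts on `ℂ^ι` -/

namespace EuclideanSpace

variable {ι : Type*} [Fintype ι]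

/-- The real part does not increase the norm: `‖Re w‖ ≤ ‖w‖`. [folklore] -/
theorem norm_realPart_le (w : EuclideanSpace ℂ ι) : ‖realPart w‖ ≤ ‖w‖ := by
  rw [EuclideanSpace.norm_eq, EuclideanSpace.norm_eq]
  gcongr with i
  rw [realPart_apply, Real.norm_eq_abs]
  exact Complex.abs_re_le_norm (w i)

/-- Real pairings against a real part: `⟪v, Re z⟫_ℝ = Re ⟪complexify v, z⟫_ℂ`. [folklore] -/
theorem inner_realPart_eq_re_inner (v : EuclideanSpace ℝ ι) (z : EuclideanSpace ℂ ι) :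
    inner ℝ v (realPart z) = (inner ℂ (complexify v) z).re := by
  rw [real_inner_comm, ← re_inner_complexify_right, ← inner_conj_symm, Complex.conj_re]

/-- `complexify (Re z) = ½ (z + z̄)` on `ℂ^ι`. [folklore] -/
theorem complexify_realPart_eq (z : EuclideanSpace ℂ ι) :
    complexify (realPart z) = (2 : ℂ)⁻¹ • (z + conjVec z) := by
  ext i
  simp only [complexify_apply, realPart_apply, PiLp.smul_apply, PiLp.add_apply, conjVec_apply,
    smul_eq_mul]
  apply Complex.ext
  · simp; ring
  · simp

end EuclideanSpace

namespace Torus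

variable {d : Type*} [Fintype d]

/-! ## Fourier coefficients of finite sums -/

section CharacterSums

variable {V : Type*} [NormedAddCommGroup V] [NormedSpace ℂ V]

/-- Integrability of `e_{-k} • f` for continuous `f` (compact torus). [folklore] -/
theorem integrable_mFourier_smul_of_continuous {f : UnitAddTorus d → V} (hf : Continuous f)
    (k : d → ℤ) : Integrable (fun x => mFourier (-k) x • f x) volume :=
  ((mFourier (-k)).continuous.smul hf).integrable_unitAddTorus

/-- **Fourier coefficients of a finite sum of vector-valued characters**:
`𝓕(∑_{i∈T} e_{n i} • v i)(k) = ∑_{i∈T, n i = k} v i` (orthonormality of the characters,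
Grafakos 2014, (3.1.5) / proof of Prop. 3.2.7 (1)). [cite: Grafakos2014, §3.1.1] -/
theorem mFourierCoeff_sum_mFourier_smul [CompleteSpace V] {ι : Type*} (T : Finset ι)
    (n : ι → (d → ℤ)) (v : ι → V) (k : d → ℤ) :
    mFourierCoeff (fun x => ∑ i ∈ T, mFourier (n i) x • v i) k =
      ∑ i ∈ T, if n i = k then v i else 0 := by
  rw [mFourierCoeff_eq_integral_volume]
  simp only [Finset.smul_sum]
  rw [integral_finsetSum _ fun i _ => ?_]
  · refine Finset.sum_congr rfl fun i _ => ?_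
    simp_rw [smul_smul]
    rw [integral_smul_const, integral_mFourier_neg_mul_mFourier]
    by_cases h : n i = k
    · subst h; simp
    · rw [if_neg (Ne.symm h), if_neg h, zero_smul]
  · simp_rw [smul_smul]
    exact (((mFourier (-k)).continuous.mul (mFourier (n i)).continuous).smul
      continuous_const).integrable_unitAddTorus

/-- Fourier coefficients of a finite sum of integrable functions. [folklore] -/
theorem mFourierCoeff_finset_sum {ι : Type*} (T : Finset ι) {f : ι → UnitAddTorus d → V}
    (hf : ∀ i ∈ T, Integrable (f i) volume) (k : d → ℤ) :
    mFourierCoeff (fun x => ∑ i ∈ T, f i x) k = ∑ i ∈ T, mFourierCoeff (f i) k := by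
  simp only [mFourierCoeff_eq_integral_volume, Finset.smul_sum]
  exact integral_finsetSum _ fun i hi => integrable_mFourier_smul' (hf i hi) k

end CharacterSums

/-! ## Pairing an integrable field with a real trigonometric polynomial -/

section Pairing

/-- A real trigonometric polynomial as the finite sum of its real modes:
`realTrigPoly S c x = ∑_{k∈S} Re (e_k(x) • c k)`. [folklore] -/
theorem realTrigPoly_apply_eq_sum (S : Finset (d → ℤ)) (c : (d → ℤ) → EuclideanSpace ℂ d)
    (x : UnitAddTorus d) :
    realTrigPoly S c x = ∑ k ∈ S, EuclideanSpace.realPart (mFourier k x • c k) := by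
  rw [realTrigPoly_apply, trigPoly_apply, map_sum]

/-- Pointwise bound: `‖realTrigPoly S c x‖ ≤ ∑_{k∈S} ‖c k‖`. [folklore] -/
theorem norm_realTrigPoly_apply_le (S : Finset (d → ℤ)) (c : (d → ℤ) → EuclideanSpace ℂ d)
    (x : UnitAddTorus d) : ‖realTrigPoly S c x‖ ≤ ∑ k ∈ S, ‖c k‖ := by
  rw [realTrigPoly_apply_eq_sum]
  refine (norm_sum_le _ _).trans (Finset.sum_le_sum fun k _ => ?_)
  refine (EuclideanSpace.norm_realPart_le _).trans ?_
  rw [norm_smul]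
  calc ‖mFourier k x‖ * ‖c k‖ ≤ 1 * ‖c k‖ := by
        gcongr
        exact ((mFourier k).norm_coe_le_norm x).trans_eq mFourier_norm
    _ = ‖c k‖ := one_mul _

/-- **Pairing with a single real mode.** For an integrable real field `w`, a frequency `k` and a
vector `z ∈ ℂ^d`: `∫ ⟪w, Re (e_k • z)⟫ = Re ⟪ŵ(k), z⟫_ℂ`, `ŵ = 𝓕(complexify ∘ w)`
(`ŵ(k) = ∫ e_{-k} w`; Grafakos 2014, §3.1.1). [cite: Grafakos2014, §3.1.1] -/
theorem integral_inner_realPart_mFourier_smul {w : UnitAddTorus d → EuclideanSpace ℝ d}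
    (hw : Integrable w volume) (k : d → ℤ) (z : EuclideanSpace ℂ d) :
    ∫ x, inner ℝ (w x) (EuclideanSpace.realPart (mFourier k x • z)) =
      (inner ℂ (mFourierCoeff (EuclideanSpace.complexify ∘ w) k) z).re := by
  -- the integrand is `Re ⟪z, e_{-k} • complexify w⟫` (up to conjugation)
  have hpt : ∀ x, inner ℝ (w x) (EuclideanSpace.realPart (mFourier k x • z)) =
      (inner ℂ z (mFourier (-k) x • EuclideanSpace.complexify (w x))).re := by
    intro x
    rw [EuclideanSpace.inner_realPart_eq_re_inner, inner_smul_right, inner_smul_right, mFourier_neg,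
      ← inner_conj_symm z (EuclideanSpace.complexify (w x)), ← map_mul, Complex.conj_re]
  simp_rw [hpt]
  have hint : Integrable (fun x => mFourier (-k) x • EuclideanSpace.complexify (w x)) volume :=
    integrable_mFourier_smul' (integrable_complexify_comp hw) k
  have h1 : ∫ x, (inner ℂ z (mFourier (-k) x • EuclideanSpace.complexify (w x))).re =
      (∫ x, inner ℂ z (mFourier (-k) x • EuclideanSpace.complexify (w x))).re := by
    have h := integral_re (𝕜 := ℂ) (hint.const_inner z)
    simpa only [RCLike.re_to_complex] using h
  rw [h1, integral_inner hint z, ← mFourierCoeff_eq_integral_volume, ← inner_conj_symm,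
    Complex.conj_re]
  rfl

/-- Integrability of the pairing of an integrable field with a continuous one. [folklore] -/
theorem integrable_inner_of_continuous {w a : UnitAddTorus d → EuclideanSpace ℝ d}
    (hw : Integrable w volume) (ha : Continuous a) :
    Integrable (fun x => inner ℝ (w x) (a x)) volume := by
  obtain ⟨C, hC⟩ := (isCompact_univ.image ha).isBounded.exists_norm_le
  have hC' : ∀ x, ‖a x‖ ≤ C := fun x => hC _ ⟨x, mem_univ _, rfl⟩
  refine Integrable.mono' (hw.norm.mul_const C)
    (hw.aestronglyMeasurable.inner ha.aestronglyMeasurable) (ae_of_all _ fun x => ?_)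
  exact (norm_inner_le_norm _ _).trans (mul_le_mul_of_nonneg_left (hC' x) (norm_nonneg _))

/-- **The general pairing formula.** For an integrable real field `w`, any finite `S ⊆ ℤ^d` and
any coefficient family `c` (no symmetry, no reality condition):
`∫ ⟪w, realTrigPoly S c⟫ = ∑_{k∈S} Re ⟪ŵ(k), c k⟫_ℂ` (finite sum of single-mode pairings;
Grafakos 2014, §3.1.1 / Prop. 3.2.7). This is how the Galerkin equations tested against real
modes are read in Fourier variables (Robinson–Rodrigo–Sadowski 2016, (4.2)/(4.5)). [cite: Grafakos2014, §3.1.1] -/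
theorem integral_inner_realTrigPoly_of_integrable (S : Finset (d → ℤ))
    (c : (d → ℤ) → EuclideanSpace ℂ d) {w : UnitAddTorus d → EuclideanSpace ℝ d}
    (hw : Integrable w volume) :
    ∫ x, inner ℝ (w x) (realTrigPoly S c x) =
      ∑ k ∈ S, (inner ℂ (mFourierCoeff (EuclideanSpace.complexify ∘ w) k) (c k)).re := by
  simp_rw [realTrigPoly_apply_eq_sum, inner_sum]
  rw [integral_finsetSum _ fun k _ => ?_]
  · exact Finset.sum_congr rfl fun k _ => integral_inner_realPart_mFourier_smul hw k (c k)
  · have hcont : Continuous fun x => EuclideanSpace.realPart (mFourier k x • c k) :=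
      EuclideanSpace.realPart.continuous.comp ((mFourier k).continuous.smul continuous_const)
    exact integrable_inner_of_continuous hw hcont

/-- The general pairing formula with the trigonometric polynomial on the left:
`∫ ⟪realTrigPoly S c, w⟫ = ∑_{k∈S} Re ⟪c k, ŵ(k)⟫_ℂ`. [folklore] -/
theorem integral_inner_realTrigPoly_of_integrable_left (S : Finset (d → ℤ))
    (c : (d → ℤ) → EuclideanSpace ℂ d) {w : UnitAddTorus d → EuclideanSpace ℝ d}
    (hw : Integrable w volume) :
    ∫ x, inner ℝ (realTrigPoly S c x) (w x) =
      ∑ k ∈ S, (inner ℂ (c k) (mFourierCoeff (EuclideanSpace.complexify ∘ w) k)).re := by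
  have hcomm : ∀ x, inner ℝ (realTrigPoly S c x) (w x) = inner ℝ (w x) (realTrigPoly S c x) :=
    fun x => real_inner_comm _ _
  simp_rw [hcomm]
  rw [integral_inner_realTrigPoly_of_integrable S c hw]
  refine Finset.sum_congr rfl fun k _ => ?_
  rw [← inner_conj_symm, Complex.conj_re]

end Pairing

/-! ## Fourier coefficients of real trigonometric polynomials with arbitrary coefficients -/

section Coefficients

/-- Complexification of a real trigonometric polynomial with arbitrary coefficients:
`complexify (realTrigPoly S c x) = ½ (∑_{k∈S} e_k(x) • c k + ∑_{k∈S} e_{-k}(x) • conj (c k))`. [folklore] -/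
theorem complexify_realTrigPoly_eq (S : Finset (d → ℤ)) (c : (d → ℤ) → EuclideanSpace ℂ d)
    (x : UnitAddTorus d) :
    EuclideanSpace.complexify (realTrigPoly S c x) =
      (2 : ℂ)⁻¹ • ((∑ k ∈ S, mFourier k x • c k) +
        ∑ k ∈ S, mFourier (-k) x • EuclideanSpace.conjVec (c k)) := by
  rw [realTrigPoly_apply, EuclideanSpace.complexify_realPart_eq, trigPoly_apply,
    EuclideanSpace.conjVec_sum]
  simp_rw [EuclideanSpace.conjVec_smul, ← mFourier_neg]

/-- **Fourier coefficients of a real trigonometric polynomial, general coefficients**: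
`𝓕(complexify ∘ realTrigPoly S c)(k) = ½ (𝟙_S(k) c k + conj (𝟙_S(-k) c (-k)))`
(orthonormality of the characters, Grafakos 2014, (3.1.5); for conjugate-symmetric `c` on a
symmetric `S` this is `TorusTrigPoly`'s `mFourierCoeff_realTrigPoly`). [cite: Grafakos2014, §3.1.1] -/
theorem mFourierCoeff_realTrigPoly_eq [DecidableEq d] (S : Finset (d → ℤ))
    (c : (d → ℤ) → EuclideanSpace ℂ d) (k : d → ℤ) :
    mFourierCoeff (EuclideanSpace.complexify ∘ realTrigPoly S c) k =
      (2 : ℂ)⁻¹ • ((if k ∈ S then c k else 0) +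
        EuclideanSpace.conjVec (if -k ∈ S then c (-k) else 0)) := by
  have hfun : (EuclideanSpace.complexify ∘ realTrigPoly S c) =
      (2 : ℂ)⁻¹ • fun x => ((∑ k ∈ S, mFourier k x • c k) +
        ∑ k ∈ S, mFourier (-k) x • EuclideanSpace.conjVec (c k)) := by
    funext x
    exact complexify_realTrigPoly_eq S c x
  rw [hfun, mFourierCoeff_const_smul]
  congr 1
  have h1 : Integrable (fun x => ∑ k ∈ S, mFourier k x • c k) volume :=
    (continuous_trigPoly S c).integrable_unitAddTorus
  have h2 : Integrable (fun x => ∑ k ∈ S, mFourier (-k) x • EuclideanSpace.conjVec (c k))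
      volume :=
    (continuous_finsetSum S fun k _ =>
      (mFourier (-k)).continuous.smul continuous_const).integrable_unitAddTorus
  have hadd : mFourierCoeff (fun x => (∑ k ∈ S, mFourier k x • c k) +
      ∑ k ∈ S, mFourier (-k) x • EuclideanSpace.conjVec (c k)) k =
      mFourierCoeff (fun x => ∑ k ∈ S, mFourier k x • c k) k +
        mFourierCoeff (fun x => ∑ k ∈ S, mFourier (-k) x • EuclideanSpace.conjVec (c k)) k := by
    simp only [mFourierCoeff_eq_integral_volume, smul_add]
    exact integral_add (integrable_mFourier_smul' h1 k) (integrable_mFourier_smul' h2 k)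
  rw [hadd, mFourierCoeff_sum_mFourier_smul, mFourierCoeff_sum_mFourier_smul, Finset.sum_ite_eq']
  congr 1
  -- the conjugate sum: `∑_{j∈S} [ -j = k ] conj (c j) = conj (𝟙_S(-k) c (-k))`
  have hre : ∀ j ∈ S, (if -j = k then EuclideanSpace.conjVec (c j) else 0) =
      if j = -k then EuclideanSpace.conjVec (c j) else 0 := by
    intro j _
    by_cases h : j = -k
    · rw [if_pos h, if_pos (by rw [h, neg_neg])]
    · rw [if_neg h, if_neg (fun h' => h (by rw [← h', neg_neg]))]
  rw [Finset.sum_congr rfl hre, Finset.sum_ite_eq']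
  split_ifs
  · rfl
  · exact EuclideanSpace.conjVec_zero.symm

/-- Off `S ∪ -S` the Fourier coefficients of `realTrigPoly S c` vanish (any `c`). [folklore] -/
theorem mFourierCoeff_realTrigPoly_eq_zero_of_not_mem [DecidableEq d] {S : Finset (d → ℤ)}
    (c : (d → ℤ) → EuclideanSpace ℂ d) {k : d → ℤ} (hk : k ∉ S) (hk' : -k ∉ S) :
    mFourierCoeff (EuclideanSpace.complexify ∘ realTrigPoly S c) k = 0 := by
  rw [mFourierCoeff_realTrigPoly_eq, if_neg hk, if_neg hk', EuclideanSpace.conjVec_zero,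
    add_zero, smul_zero]

/-- A real trigonometric polynomial over a frequency ball is band-limited to that ball (any `c`). [folklore] -/
theorem mFourierCoeff_realTrigPoly_freqBall_eq_zero [DecidableEq d] {N : ℕ}
    (c : (d → ℤ) → EuclideanSpace ℂ d) {k : d → ℤ} (hk : (N : ℝ) ^ 2 < freqNormSq k) :
    mFourierCoeff (EuclideanSpace.complexify ∘ realTrigPoly (freqBall N) c) k = 0 :=
  mFourierCoeff_realTrigPoly_eq_zero_of_not_mem c (not_mem_freqBall.2 hk)
    (not_mem_freqBall.2 (by rwa [freqNormSq_neg]))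

end Coefficients

/-! ## The Laplacian in Fourier variables -/

section Laplacian

variable [DecidableEq d]

/-- **Fourier coefficients of the Laplacian**: `𝓕(complexify ∘ Δa)(k) = -4π²|k|² â(k)` for
smooth `a : T^d → ℝ^d` (Grafakos 2014, Prop. 3.2.6 (8) twice). [cite: Grafakos2014, Prop. 3.2.6] -/
theorem mFourierCoeff_complexify_laplacian {a : UnitAddTorus d → EuclideanSpace ℝ d}
    (ha : IsSmooth a) (k : d → ℤ) :
    mFourierCoeff (EuclideanSpace.complexify ∘ laplacian a) k =
      -(((4 * Real.pi ^ 2 * freqNormSq k : ℝ) : ℂ) •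
        mFourierCoeff (EuclideanSpace.complexify ∘ a) k) := by
  have hfun : (EuclideanSpace.complexify ∘ laplacian a) =
      fun x => ∑ i, (EuclideanSpace.complexify ∘ partialDeriv i (partialDeriv i a)) x := by
    funext x
    rw [Function.comp_apply, laplacian_eq_sum_partialDeriv_partialDeriv ha, map_sum]
    rfl
  rw [hfun, mFourierCoeff_finset_sum _ fun i _ =>
    integrable_complexify_comp ((ha.partialDeriv i).partialDeriv i).integrable]
  simp_rw [mFourierCoeff_complexify_partialDeriv (ha.partialDeriv _),
    mFourierCoeff_complexify_partialDeriv ha, smul_smul, ← Finset.sum_smul, ← neg_smul]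
  congr 1
  rw [freqNormSq]
  push_cast
  rw [Finset.mul_sum, ← Finset.sum_neg_distrib]
  refine Finset.sum_congr rfl fun i _ => ?_
  linear_combination ((2 : ℂ) * Real.pi * (k i : ℂ)) ^ 2 * Complex.I_mul_I

omit [DecidableEq d] in
/-- Finite sums of real trigonometric polynomials over the same `S` add coefficientwise. [folklore] -/
theorem sum_realTrigPoly {ι : Type*} (T : Finset ι) (S : Finset (d → ℤ))
    (c : ι → (d → ℤ) → EuclideanSpace ℂ d) (x : UnitAddTorus d) :
    ∑ i ∈ T, realTrigPoly S (c i) x = realTrigPoly S (fun k => ∑ i ∈ T, c i k) x := by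
  simp only [realTrigPoly_apply, trigPoly_apply, ← map_sum]
  congr 1
  rw [Finset.sum_comm]
  simp [Finset.smul_sum]

/-- **The Laplacian acts diagonally on real trigonometric polynomials**:
`Δ (realTrigPoly S c) = realTrigPoly S (k ↦ -4π²|k|² • c k)`
(`∂ⱼ∂ⱼ` contributes `(2πi kⱼ)²`; Grafakos 2014, Prop. 3.2.6 (8)). [cite: Grafakos2014, Prop. 3.2.6] -/
theorem laplacian_realTrigPoly (S : Finset (d → ℤ)) (c : (d → ℤ) → EuclideanSpace ℂ d)
    (x : UnitAddTorus d) :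
    laplacian (realTrigPoly S c) x =
      realTrigPoly S (fun k => -(((4 * Real.pi ^ 2 * freqNormSq k : ℝ) : ℂ) • c k)) x := by
  rw [laplacian_eq_sum_partialDeriv_partialDeriv (isSmooth_realTrigPoly S c)]
  simp_rw [partialDeriv_realTrigPoly' S _ _, smul_smul]
  rw [sum_realTrigPoly]
  refine congrFun (congrArg (realTrigPoly S) (funext fun k => ?_)) x
  rw [← Finset.sum_smul, ← neg_smul]
  congr 1
  rw [freqNormSq]
  push_cast
  rw [Finset.mul_sum, ← Finset.sum_neg_distrib]
  refine Finset.sum_congr rfl fun i _ => ?_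
  linear_combination ((2 : ℂ) * Real.pi * (k i : ℂ)) ^ 2 * Complex.I_mul_I

end Laplacian

/-! ## Derivative bounds for `C¹` fields and for real trigonometric polynomials -/

section DerivBounds

variable [DecidableEq d]

/-- `‖Df(x) h‖ ≤ ‖h‖ ∑ᵢ ‖∂ᵢ f(x)‖` for `C¹` fields on the torus
(`Df(x) h = ∑ᵢ hᵢ ∂ᵢf(x)`, `|hᵢ| ≤ ‖h‖`). [folklore] -/
theorem norm_fderiv_apply_le {F : Type*} [NormedAddCommGroup F] [NormedSpace ℝ F]
    {f : UnitAddTorus d → F} (hf : IsContDiff 1 f) (x : UnitAddTorus d)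
    (h : EuclideanSpace ℝ d) :
    ‖Torus.fderiv f x h‖ ≤ ‖h‖ * ∑ i, ‖partialDeriv i f x‖ := by
  rw [fderiv_apply_eq_sum_partialDeriv hf, Finset.mul_sum]
  refine (norm_sum_le _ _).trans (Finset.sum_le_sum fun i _ => ?_)
  rw [norm_smul]
  exact mul_le_mul_of_nonneg_right (by simpa using PiLp.norm_apply_le h i) (norm_nonneg _)

/-- The convective derivative along `u` of a `C¹` field: `‖(u·∇)a (x)‖ ≤ ‖u x‖ ∑ᵢ ‖∂ᵢ a(x)‖`. [folklore] -/
theorem norm_convect_le {F : Type*} [NormedAddCommGroup F] [NormedSpace ℝ F]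
    (u : UnitAddTorus d → EuclideanSpace ℝ d) {a : UnitAddTorus d → F} (ha : IsContDiff 1 a)
    (x : UnitAddTorus d) :
    ‖convect u a x‖ ≤ ‖u x‖ * ∑ i, ‖partialDeriv i a x‖ :=
  norm_fderiv_apply_le ha x (u x)

/-- Partial derivatives of a real trigonometric polynomial, pointwise bound:
`‖∂ⱼ realTrigPoly S c (x)‖ ≤ ∑_{k∈S} 2π |kⱼ| ‖c k‖`. [folklore] -/
theorem norm_partialDeriv_realTrigPoly_le (S : Finset (d → ℤ))
    (c : (d → ℤ) → EuclideanSpace ℂ d) (j : d) (x : UnitAddTorus d) :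
    ‖partialDeriv j (realTrigPoly S c) x‖ ≤ ∑ k ∈ S, 2 * Real.pi * |(k j : ℝ)| * ‖c k‖ := by
  rw [partialDeriv_realTrigPoly]
  refine (norm_realTrigPoly_apply_le _ _ _).trans (Finset.sum_le_sum fun k _ => ?_)
  rw [norm_smul]
  refine le_of_eq ?_
  congr 1
  rw [show (2 * Real.pi * Complex.I * (k j : ℂ) : ℂ) = ((2 * Real.pi * (k j : ℝ) : ℝ) : ℂ) *
      Complex.I by push_cast; ring]
  rw [norm_mul, Complex.norm_I, mul_one, Complex.norm_real, Real.norm_eq_abs, abs_mul,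
    abs_of_pos Real.two_pi_pos]

omit [DecidableEq d] in
/-- `|kⱼ| ≤ ‖k‖ := (freqNormSq k)^{1/2}` coordinatewise. [folklore] -/
theorem abs_apply_le_sqrt_freqNormSq (k : d → ℤ) (j : d) :
    |(k j : ℝ)| ≤ Real.sqrt (freqNormSq k) := by
  rw [← Real.sqrt_sq_eq_abs]
  exact Real.sqrt_le_sqrt (Finset.single_le_sum (f := fun i => ((k i : ℝ)) ^ 2)
    (fun i _ => sq_nonneg _) (Finset.mem_univ j))

end DerivBounds

/-! ## Single real modes `Re (e_k • z)` -/

section SingleMode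

variable [DecidableEq d]

omit [DecidableEq d] in
/-- The single real mode: `realTrigPoly {k} c x = Re (e_k(x) • c k)`. [folklore] -/
theorem realTrigPoly_singleton_apply (k : d → ℤ) (c : (d → ℤ) → EuclideanSpace ℂ d)
    (x : UnitAddTorus d) :
    realTrigPoly {k} c x = EuclideanSpace.realPart (mFourier k x • c k) := by
  rw [realTrigPoly_apply_eq_sum, Finset.sum_singleton]

omit [DecidableEq d] in
/-- Pointwise bound for a single real mode: `‖Re (e_k(x) • z)‖ ≤ ‖z‖`. [folklore] -/
theorem norm_realTrigPoly_singleton_le (k : d → ℤ) (c : (d → ℤ) → EuclideanSpace ℂ d)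
    (x : UnitAddTorus d) : ‖realTrigPoly {k} c x‖ ≤ ‖c k‖ := by
  simpa using norm_realTrigPoly_apply_le {k} c x

omit [DecidableEq d] in
/-- `∫ ‖Re (e_k • z)‖² ≤ ‖z‖²` (the torus has volume one). [folklore] -/
theorem integral_norm_sq_realTrigPoly_singleton_le (k : d → ℤ)
    (c : (d → ℤ) → EuclideanSpace ℂ d) :
    ∫ x, ‖realTrigPoly {k} c x‖ ^ 2 ≤ ‖c k‖ ^ 2 := by
  have h : ∫ x, ‖realTrigPoly {k} c x‖ ^ 2 ≤ ∫ _ : UnitAddTorus d, ‖c k‖ ^ 2 := by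
    refine integral_mono (((memLp_realTrigPoly {k} c 2).integrable_norm_pow two_ne_zero))
      (integrable_const _) fun x => ?_
    exact pow_le_pow_left₀ (norm_nonneg _) (norm_realTrigPoly_singleton_le k c x) 2
  simpa using h

omit [DecidableEq d] in
/-- Pairing an integrable field with a single real mode:
`∫ ⟪w, Re (e_k • z)⟫ = Re ⟪ŵ(k), z⟫_ℂ`. [folklore] -/
theorem integral_inner_realTrigPoly_singleton {w : UnitAddTorus d → EuclideanSpace ℝ d}
    (hw : Integrable w volume) (k : d → ℤ) (c : (d → ℤ) → EuclideanSpace ℂ d) :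
    ∫ x, inner ℝ (w x) (realTrigPoly {k} c x) =
      (inner ℂ (mFourierCoeff (EuclideanSpace.complexify ∘ w) k) (c k)).re := by
  rw [integral_inner_realTrigPoly_of_integrable {k} c hw, Finset.sum_singleton]

/-- **Fourier coefficients of a single real mode**: supported on `{k, -k}`,
`𝓕(Re (e_k • z))(k') = ½ ([k' = k] z + [k' = -k] z̄)`. [folklore] -/
theorem mFourierCoeff_realTrigPoly_singleton (k : d → ℤ) (c : (d → ℤ) → EuclideanSpace ℂ d)
    (k' : d → ℤ) :
    mFourierCoeff (EuclideanSpace.complexify ∘ realTrigPoly {k} c) k' =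
      (2 : ℂ)⁻¹ • ((if k' = k then c k else 0) +
        EuclideanSpace.conjVec (if k' = -k then c k else 0)) := by
  rw [mFourierCoeff_realTrigPoly_eq]
  simp only [Finset.mem_singleton]
  congr 2
  · by_cases h : k' = k
    · rw [if_pos h, if_pos h, h]
    · rw [if_neg h, if_neg h]
  · by_cases h : k' = -k
    · rw [if_pos h, if_pos (by rw [h, neg_neg]), h, neg_neg]
    · rw [if_neg h, if_neg (fun h' => h (by rw [← h', neg_neg]))]

/-- A single real mode at frequency `k` has no Fourier modes at frequencies of larger length:
`|k|² < |k'|² ⟹ 𝓕(Re (e_k • z))(k') = 0`. [folklore] -/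
theorem mFourierCoeff_realTrigPoly_singleton_eq_zero (k : d → ℤ)
    (c : (d → ℤ) → EuclideanSpace ℂ d) {k' : d → ℤ} (hk' : freqNormSq k < freqNormSq k') :
    mFourierCoeff (EuclideanSpace.complexify ∘ realTrigPoly {k} c) k' = 0 := by
  refine mFourierCoeff_realTrigPoly_eq_zero_of_not_mem c ?_ ?_
  · rw [Finset.mem_singleton]
    rintro rfl
    exact lt_irrefl _ hk'
  · rw [Finset.mem_singleton]
    rintro h
    rw [← freqNormSq_neg k', h] at hk'
    exact lt_irrefl _ hk'

/-- A single real mode with transversal vector (`k · z = 0`) is divergence free. [folklore] -/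
theorem isDivFree_realTrigPoly_singleton {k : d → ℤ} {c : (d → ℤ) → EuclideanSpace ℂ d}
    (hz : ∑ j, (k j : ℂ) * c k j = 0) : IsDivFree (realTrigPoly {k} c) :=
  isDivFree_realTrigPoly fun k' hk' => by
    rw [Finset.mem_singleton] at hk'
    subst hk'
    exact hz

/-- Partial derivatives of a single real mode: `‖∂ⱼ Re (e_k • z)‖ ≤ 2π ‖k‖ ‖z‖` pointwise. [folklore] -/
theorem norm_partialDeriv_realTrigPoly_singleton_le (k : d → ℤ)
    (c : (d → ℤ) → EuclideanSpace ℂ d) (j : d) (x : UnitAddTorus d) :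
    ‖partialDeriv j (realTrigPoly {k} c) x‖ ≤ 2 * Real.pi * Real.sqrt (freqNormSq k) * ‖c k‖ := by
  refine (norm_partialDeriv_realTrigPoly_le {k} c j x).trans ?_
  rw [Finset.sum_singleton]
  gcongr
  exact abs_apply_le_sqrt_freqNormSq k j

/-- The convective derivative along a single real mode:
`‖(u·∇) Re (e_k • z) (x)‖ ≤ (#d · 2π ‖k‖ ‖z‖) ‖u x‖`. [folklore] -/
theorem norm_convect_realTrigPoly_singleton_le (u : UnitAddTorus d → EuclideanSpace ℝ d)
    (k : d → ℤ) (c : (d → ℤ) → EuclideanSpace ℂ d) (x : UnitAddTorus d) :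
    ‖convect u (realTrigPoly {k} c) x‖ ≤
      ‖u x‖ * (Fintype.card d * (2 * Real.pi * Real.sqrt (freqNormSq k) * ‖c k‖)) := by
  refine (norm_convect_le u ((isSmooth_realTrigPoly {k} c).isContDiff (by simp)) x).trans ?_
  gcongr
  calc ∑ i, ‖partialDeriv i (realTrigPoly {k} c) x‖
      ≤ ∑ _i : d, 2 * Real.pi * Real.sqrt (freqNormSq k) * ‖c k‖ :=
        Finset.sum_le_sum fun i _ => norm_partialDeriv_realTrigPoly_singleton_le k c i x
    _ = Fintype.card d * (2 * Real.pi * Real.sqrt (freqNormSq k) * ‖c k‖) := by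
        rw [Finset.sum_const, Finset.card_univ, nsmul_eq_mul]

/-- The Laplacian of a single real mode: `Δ Re (e_k • z) = -4π²|k|² Re (e_k • z)`. [folklore] -/
theorem laplacian_realTrigPoly_singleton (k : d → ℤ) (c : (d → ℤ) → EuclideanSpace ℂ d)
    (x : UnitAddTorus d) :
    laplacian (realTrigPoly {k} c) x = -(4 * Real.pi ^ 2 * freqNormSq k) • realTrigPoly {k} c x := by
  rw [laplacian_realTrigPoly, realTrigPoly_singleton_apply, realTrigPoly_singleton_apply,
    smul_neg, map_neg, smul_comm, Complex.coe_smul, map_smul, ← neg_smul]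

end SingleMode

/-! ## Band-limited continuous fields are trigonometric polynomials -/

section BandLimited

variable [DecidableEq d]

/-- **A continuous band-limited field is its own truncation**: if `a : T^d → ℝ^d` is continuous
and `â(k) = 0` for `|k|² > N²`, then `P_N a = a` (the truncation error has all Fourier
coefficients zero, hence vanishes in `L²`, `lintegral_enorm_sq_fourierTruncate_sub`; two
continuous functions that agree a.e. agree). In particular every Galerkin field is the real
trigonometric polynomial of its own coefficients (Robinson–Rodrigo–Sadowski 2016, §4.1). [cite: RobinsonRodrigoSadowski2016, §4.1] -/
theorem fourierTruncate_eq_self {a : UnitAddTorus d → EuclideanSpace ℝ d} (ha : Continuous a)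
    {N : ℕ} (hband : ∀ k, (N : ℝ) ^ 2 < freqNormSq k →
      mFourierCoeff (EuclideanSpace.complexify ∘ a) k = 0) :
    fourierTruncate N a = a := by
  have hmem : MemLp a 2 volume := ha.memLp_of_hasCompactSupport (HasCompactSupport.of_compactSpace a)
  have h0 : ∫⁻ x, ‖fourierTruncate N a x - a x‖ₑ ^ 2 = 0 := by
    rw [lintegral_enorm_sq_fourierTruncate_sub hmem, ENNReal.tsum_eq_zero]
    rintro ⟨k, hk⟩
    rw [hband k (not_mem_freqBall.1 hk), enorm_zero, zero_pow two_ne_zero]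
  have hae : fourierTruncate N a =ᵐ[volume] a := by
    have hmeas : AEMeasurable (fun x => ‖fourierTruncate N a x - a x‖ₑ ^ 2) volume :=
      ((continuous_fourierTruncate N a).sub ha).enorm.aemeasurable.pow_const 2
    have h := (lintegral_eq_zero_iff' hmeas).1 h0
    filter_upwards [h] with x hx
    have hx' : ‖fourierTruncate N a x - a x‖ₑ = 0 := by
      simpa using hx
    rwa [enorm_eq_zero, sub_eq_zero] at hx'
  exact (Continuous.ae_eq_iff_eq volume (continuous_fourierTruncate N a) ha).1 hae

/-- Energy of a continuous band-limited field: `∫ ‖a‖² = ∑_{|k|≤N} ‖â k‖²`. [folklore] -/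
theorem integral_norm_sq_eq_sum_of_band_limited {a : UnitAddTorus d → EuclideanSpace ℝ d}
    (ha : Continuous a) {N : ℕ} (hband : ∀ k, (N : ℝ) ^ 2 < freqNormSq k →
      mFourierCoeff (EuclideanSpace.complexify ∘ a) k = 0) :
    ∫ x, ‖a x‖ ^ 2 = ∑ k ∈ freqBall N, ‖mFourierCoeff (EuclideanSpace.complexify ∘ a) k‖ ^ 2 := by
  conv_lhs => rw [← fourierTruncate_eq_self ha hband]
  exact integral_norm_sq_fourierTruncate ha.integrable_unitAddTorus N

/-- Spectral gradient norm of a continuous band-limited field: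
`‖∇a‖₂² = 4π² ∑_{|k|≤N} |k|² ‖â k‖²` (finite, in `ℝ≥0∞` via `ofReal`). [folklore] -/
theorem eGradNormSq_eq_sum_of_band_limited {a : UnitAddTorus d → EuclideanSpace ℝ d}
    (ha : Continuous a) {N : ℕ} (hband : ∀ k, (N : ℝ) ^ 2 < freqNormSq k →
      mFourierCoeff (EuclideanSpace.complexify ∘ a) k = 0) :
    eGradNormSq a = ENNReal.ofReal (4 * Real.pi ^ 2 *
      ∑ k ∈ freqBall N, freqNormSq k * ‖mFourierCoeff (EuclideanSpace.complexify ∘ a) k‖ ^ 2) := by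
  conv_lhs => rw [← fourierTruncate_eq_self ha hband, fourierTruncate_eq]
  exact eGradNormSq_realTrigPoly neg_mem_freqBall_of_mem
    (isConjSymm_mFourierCoeff ha.integrable_unitAddTorus)

/-- Sup bound for a continuous band-limited field: `‖a x‖ ≤ ∑_{|k|≤N} ‖â k‖`. [folklore] -/
theorem norm_apply_le_sum_of_band_limited {a : UnitAddTorus d → EuclideanSpace ℝ d}
    (ha : Continuous a) {N : ℕ} (hband : ∀ k, (N : ℝ) ^ 2 < freqNormSq k →
      mFourierCoeff (EuclideanSpace.complexify ∘ a) k = 0) (x : UnitAddTorus d) :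
    ‖a x‖ ≤ ∑ k ∈ freqBall N, ‖mFourierCoeff (EuclideanSpace.complexify ∘ a) k‖ := by
  conv_lhs => rw [← fourierTruncate_eq_self ha hband, fourierTruncate_eq]
  exact norm_realTrigPoly_apply_le _ _ x

omit [DecidableEq d] in
/-- **Parseval against a band-limited field is a finite sum**: if `â(k) = 0` off `S`, then
`∫ ⟪u, a⟫ = ∑_{k∈S} Re ⟪û k, â k⟫` for `u, a ∈ L²(T^d; ℝ^d)`. [cite: Grafakos2014, Prop. 3.2.7] -/
theorem integral_inner_eq_sum_of_band_limited {u a : UnitAddTorus d → EuclideanSpace ℝ d}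
    (hu : MemLp u 2 volume) (ha : MemLp a 2 volume) {S : Finset (d → ℤ)}
    (hband : ∀ k ∉ S, mFourierCoeff (EuclideanSpace.complexify ∘ a) k = 0) :
    ∫ x, ⟪u x, a x⟫_ℝ =
      ∑ k ∈ S, (inner ℂ (mFourierCoeff (EuclideanSpace.complexify ∘ u) k)
        (mFourierCoeff (EuclideanSpace.complexify ∘ a) k)).re := by
  have h1 := hasSum_re_inner_mFourierCoeff_complexify hu ha
  have h2 : HasSum (fun k : d → ℤ => (inner ℂ (mFourierCoeff (EuclideanSpace.complexify ∘ u) k)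
      (mFourierCoeff (EuclideanSpace.complexify ∘ a) k)).re)
      (∑ k ∈ S, (inner ℂ (mFourierCoeff (EuclideanSpace.complexify ∘ u) k)
        (mFourierCoeff (EuclideanSpace.complexify ∘ a) k)).re) :=
    hasSum_sum_of_ne_finset_zero fun k hk => by rw [hband k hk, inner_zero_right, Complex.zero_re]
  exact h1.unique h2

/-- The same over a frequency ball, hypothesis in the `N² < |k|²` form. [folklore] -/
theorem integral_inner_eq_sum_freqBall {u a : UnitAddTorus d → EuclideanSpace ℝ d}
    (hu : MemLp u 2 volume) (ha : MemLp a 2 volume) {N : ℕ}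
    (hband : ∀ k, (N : ℝ) ^ 2 < freqNormSq k → mFourierCoeff (EuclideanSpace.complexify ∘ a) k = 0) :
    ∫ x, ⟪u x, a x⟫_ℝ =
      ∑ k ∈ freqBall N, (inner ℂ (mFourierCoeff (EuclideanSpace.complexify ∘ u) k)
        (mFourierCoeff (EuclideanSpace.complexify ∘ a) k)).re :=
  integral_inner_eq_sum_of_band_limited hu ha fun k hk => hband k (not_mem_freqBall.1 hk)

end BandLimited

end Torus

end Literature.Analysis.FunctionSpaces
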